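import Summits.BirchSwinnertonDyer.Rank1Residual.X11b.Three.GaloisImageSpansEnd
import Summits.BirchSwinnertonDyer.Rank1Residual.X11b.Three.MoritaDuality
import HarnessLib

/-!
# X11b at `p = 3` (team N8/O2), LINE-K sub-target E-K8 · IMG3-GEN (curve level, the U2 core):
# if `ρ̄_{E,p}` is onto, a Galois-stable subgroup of `Hom(C, E[p^{k+1}])` detecting every `c ≠ 0`
# is ALL of `Hom(C, E[p^{k+1}])` (cell `b2b-bsdres`, team `x11b3`, seat p2)

HONEST FRAMING (verbatim, cell `b2b-bsdres`, run/shared/lean/b2b/bsd-rank1-residual/): the goal of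
the cell is to DELETE the COMBINATION-SHAPED residual classes for ALL analytic-rank `≤ 1` curves
over `ℚ` — "full BSD formula for every rank `≤ 1` curve in class `C`" assembled STRICTLY from
published theorems — so that the rank-`≤ 1` remainder becomes exactly the CONSTRUCTION-SHAPED
classes, which are TYPED (missing-input Props), NOT attempted; this is not "finishing BSD".
Research route (team N8/O2: STEP L at `3 ‖ N`, LINE K); ELEMENTARY Galois-module algebra; nothing
booked; no label touched; X11b@3 stays OPEN (RESIDUAL-MAP §I O2). THEOREMS ONLY; no definition;
no named fact; no `sorry`.

## What this file does (LINE-K.md ⟦r2 05:57Z⟧ block 3, U2 = McCallum 1991 §3 (2), surjectivity)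

McCallum, §3: for `L = K(E_{p^M})` and a finite `C ≤ H¹(K, E_{p^M})`, the field `L_C` cut out by
`C` satisfies `Gal(L_C/L) ≅ Hom(C, E_{p^M})`. The map `τ ↦ (c ↦ c(τ))` is injective by definition
of `L_C`; its image `V ≤ Hom(C, E_{p^M})` is a `G_K`-stable subgroup, and — once
`H¹(L/K, E_{p^M}) = 0` (U1, Sah: tree `Three/ImageSah`, `Three/TorsionNegOneLift`,
`Three/GaloisImageNegOne`) makes restriction injective on `C` — every `c ≠ 0` is detected by `V`
(`∃ f ∈ V, f c ≠ 0`). THIS FILE proves that these two properties force `V = Hom(C, E_{p^M})`,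
for every prime `p`, every level, every field of characteristic `≠ p`, from the surjectivity of
the MOD-`p` representation alone:

* `WeierstrassCurve.addSubgroup_hom_geomTorsion_eq_top_of_surj` — `W.HasSurjectiveModNGaloisRep p`,
  `(p : F) ≠ 0`, `C` a finite abelian group with `p^{k+1} C = 0`, `V ≤ Hom(C, E[p^{k+1}])` an
  additive subgroup stable under `f ↦ (σ • ·) ∘ f` (`σ ∈ Γ_F`) such that every `c ≠ 0` has some
  `f ∈ V` with `f c ≠ 0` ⟹ `V = ⊤`.

Proof (Morita for `n = 2`, inlined through a frame `e : E[p^{k+1}] ≃+ (ℤ/p^{k+1})²`): `V` is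
stable under every additive endomorphism of `E[p^{k+1}]`
(`WeierstrassCurve.comp_mem_of_forall_galois_comp_mem_of_surj`, `Three/GaloisImageSpansEnd`, built
on `Three/ImageSpan`); with the coordinate maps `π_j` and the coordinate embeddings `ι_i` of the
frame, `Y = {g : C →+ ℤ/p^{k+1} | ι₀ ∘ g ∈ V}` contains every `π_j ∘ f` (`f ∈ V`), hence detects every
`c ≠ 0`, hence is all of `Hom(C, ℤ/p^{k+1})` (`Duality.eq_top_of_forall_exists_apply_ne_zero`,
`Three/MoritaDuality`, counting with the tree's `Nat.card_addMonoidHom_zmod`); finally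
`g = ι₀ ∘ π₀ ∘ g + (ι₁ ∘ π₀) ∘ (ι₀ ∘ π₁ ∘ g) ∈ V`.

What this is NOT: no Galois cohomology (the identification of `Gal(L_C/L)`, restriction–inflation
and U1 are the consumer's, E-K9 / LINE-K K5), no claim about any class; nothing booked.

References: W. G. McCallum, LMS LNS 153 (1991) §3 [McCallum1991]; S. Lang, *Algebra* XVII §1
[Lang2002]; J. S. Milne, *Arithmetic Duality Theorems*, I §0 (0.19) [MilneADT2006]; team files
`cells/x11b3/LINE-K.md` block 3 (U2, E-K8).
-/

namespace WeierstrassCurve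

open Summit.BirchSwinnertonDyer.Rank1Residual.X11b.Three Literature.NumberTheory.EllipticCurves

universe u

variable {F : Type u} [Field F] (W : WeierstrassCurve F) [W.IsElliptic]

/-- **McCallum §3 (2), algebraic core (U2).** Let `ρ̄_{E,p}` be onto (`(p : F) ≠ 0`), `C` a
finite abelian group killed by `p^{k+1}`, and `V ≤ Hom(C, E[p^{k+1}])` an additive subgroup which is
Galois-stable (`f ∈ V ⇒ (σ • ·) ∘ f ∈ V`) and detects every non-zero element of `C`
(`c ≠ 0 ⇒ ∃ f ∈ V, f c ≠ 0`). Then `V = Hom(C, E[p^{k+1}])`. EVERY prime `p`, every level.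
[folklore] -/
theorem addSubgroup_hom_geomTorsion_eq_top_of_surj (p k : ℕ) [Fact p.Prime] (hpF : (p : F) ≠ 0)
    (hsurj : W.HasSurjectiveModNGaloisRep p) {C : Type*} [AddCommGroup C] [Finite C]
    (hC : ∀ c : C, (p ^ (k + 1)) • c = 0)
    (V : AddSubgroup (C →+ W.geomTorsion ((p ^ (k + 1) : ℕ) : ℤ)))
    (hV : ∀ (σ : Field.absoluteGaloisGroup F), ∀ f ∈ V,
      (DistribSMul.toAddMonoidHom (W.geomTorsion ((p ^ (k + 1) : ℕ) : ℤ)) σ).comp f ∈ V)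
    (hdet : ∀ c : C, c ≠ 0 → ∃ f ∈ V, f c ≠ 0) : V = ⊤ := by
  have hp : p.Prime := Fact.out
  haveI : NeZero (p ^ (k + 1)) := ⟨pow_ne_zero _ hp.ne_zero⟩
  -- notation: `T = E[p^{k+1}]`, `R = ℤ/p^{k+1}`, a frame `e`, coordinates `π j`, embeddings `ι i`
  obtain ⟨e⟩ := nonempty_addEquiv_geomTorsion W p (k + 1) (Nat.succ_le_succ (Nat.zero_le k)) hpF
  have hEnd := W.comp_mem_of_forall_galois_comp_mem_of_surj p k hpF hsurj V hV
  let π : Fin 2 → (W.geomTorsion ((p ^ (k + 1) : ℕ) : ℤ) →+ ZMod (p ^ (k + 1))) := fun j =>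
    (Pi.evalAddMonoidHom (fun _ : Fin 2 => ZMod (p ^ (k + 1))) j).comp e.toAddMonoidHom
  let ι : Fin 2 → (ZMod (p ^ (k + 1)) →+ W.geomTorsion ((p ^ (k + 1) : ℕ) : ℤ)) := fun i =>
    e.symm.toAddMonoidHom.comp (AddMonoidHom.single (fun _ : Fin 2 => ZMod (p ^ (k + 1))) i)
  have hπ : ∀ j x, π j x = e x j := fun j x => rfl
  have hι : ∀ i r, ι i r = e.symm (Pi.single i r) := fun i r => rfl
  have hπι : ∀ r, π 0 (ι 0 r) = r := fun r => by
    rw [hπ, hι, AddEquiv.apply_symm_apply, Pi.single_eq_same]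
  -- `Y = {g | ι₀ ∘ g ∈ V}`
  let Y : AddSubgroup (C →+ ZMod (p ^ (k + 1))) :=
    { carrier := {g | (ι 0).comp g ∈ V}
      add_mem' := fun {g h} hg hh => by
        change (ι 0).comp (g + h) ∈ V
        rw [AddMonoidHom.comp_add]
        exact V.add_mem hg hh
      zero_mem' := by
        change (ι 0).comp 0 ∈ V
        rw [AddMonoidHom.comp_zero]
        exact V.zero_mem
      neg_mem' := fun {g} hg => by
        change (ι 0).comp (-g) ∈ V
        rw [AddMonoidHom.comp_neg]
        exact V.neg_mem hg }
  -- `π_j ∘ f ∈ Y` for `f ∈ V` (End-stability with `φ = ι₀ ∘ π_j`)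
  have hπY : ∀ j, ∀ f ∈ V, (π j).comp f ∈ Y := fun j f hf => by
    change (ι 0).comp ((π j).comp f) ∈ V
    rw [← AddMonoidHom.comp_assoc]
    exact hEnd ((ι 0).comp (π j)) f hf
  -- `Y` detects every `c ≠ 0`, hence `Y = ⊤`
  have hY : Y = ⊤ := by
    refine Duality.eq_top_of_forall_exists_apply_ne_zero hC Y fun c hc => ?_
    obtain ⟨f, hf, hfc⟩ := hdet c hc
    have hefc : e (f c) ≠ 0 := fun h0 => hfc (e.map_eq_zero_iff.mp h0)
    obtain ⟨j, hj⟩ := Function.ne_iff.mp hefc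
    exact ⟨(π j).comp f, hπY j f hf, by rwa [AddMonoidHom.comp_apply, hπ]⟩
  -- every `g` is `ι₀ ∘ (π₀ ∘ g) + (ι₁ ∘ π₀) ∘ (ι₀ ∘ (π₁ ∘ g))`
  rw [eq_top_iff]
  rintro g -
  have h0 : (ι 0).comp ((π 0).comp g) ∈ V := by
    have : (π 0).comp g ∈ Y := by rw [hY]; exact AddSubgroup.mem_top _
    exact this
  have h1 : ((ι 1).comp (π 0)).comp ((ι 0).comp ((π 1).comp g)) ∈ V := by
    have : (π 1).comp g ∈ Y := by rw [hY]; exact AddSubgroup.mem_top _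
    exact hEnd ((ι 1).comp (π 0)) _ this
  have hg : g = (ι 0).comp ((π 0).comp g) + ((ι 1).comp (π 0)).comp ((ι 0).comp ((π 1).comp g)) := by
    refine AddMonoidHom.ext fun c => ?_
    simp only [AddMonoidHom.add_apply, AddMonoidHom.comp_apply, hπι]
    rw [hι, hι, ← map_add, hπ, hπ]
    apply e.injective
    rw [AddEquiv.apply_symm_apply]
    ext i
    fin_cases i <;> simp
  rw [hg]
  exact V.add_mem h0 h1

end WeierstrassCurve
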